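import Literature.Geometry.Kaehler.ComplexVectorBundle
import Literature.NumberTheory.Transcendental.FormsAlgebraWedgeAssocProofs
import Literature.NumberTheory.Transcendental.FormsAlgebraWedgeCommProofs
import HarnessLib

/-!
# Algebra of matrices of differential forms: associativity, scalars, graded-cyclic trace

Layer `Literature/Geometry/Kaehler`. Companion of `ComplexVectorBundle` (matrices of complex
forms `MatrixForm I M r k = Matrix (Fin r) (Fin r) (MForm I M ℂ k)` with the matrix wedge
`(A ∧ B)_{ab} = Σ_c A_{ac} ∧ B_{cb}`, left/right multiplication by matrix-valued functions
`mulLeft g A = g · A`, `mulRight A g = A · g`, degree casts and `Matrix.trace`). This file records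
the purely ALGEBRAIC identities of that calculus which the Chern–Weil computations of Kobayashi,
*Differential Geometry of Complex Vector Bundles* (1987), Ch. I §1 and Ch. II §§1–2 use silently
("`Ω' = a⁻¹ Ω a`", "`tr(Ω ∧ ⋯ ∧ Ω)` is independent of the frame", the telescoping in the proof of
(2.4) `d tr(Ωᵏ) = 0`): all pointwise consequences of the bilinearity, associativity and graded
commutativity of the wedge product of scalar forms (Warner (1983), 2.6), which are PROVED in the
tree (`ContinuousAlternatingMap.WedgeAssoc_holds`, `.WedgeComm_holds`,
`FormsAlgebraWedge{Assoc,Comm}Proofs`). No analysis (no `d`, no smoothness) enters here.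

* Scalars from the coefficient algebra: `(c • α) ∧ β = c • (α ∧ β) = α ∧ (c • β)` for `c ∈ A`
  (`ContinuousAlternatingMap.algebra_smul_wedge`, `.wedge_algebra_smul`), whence
  `mulLeft g (A ∧ B) = (mulLeft g A) ∧ B`, `(A ∧ B) · g = A ∧ (B · g)`,
  `(A · g) ∧ B = A ∧ (g · B)` (`MatrixForm.mulLeft_wedge`, `.wedge_mulRight`, `.mulRight_wedge`),
  and `g · (h · A) = (g h) · A`, `(A · g) · h = A · (g h)`, `(g · A) · h = g · (A · h)`.
* Associativity `(A ∧ B) ∧ C = A ∧ (B ∧ C)` up to the degree cast (`MatrixForm.wedge_assoc`).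
* **Graded cyclicity of the trace**: `tr(B ∧ A) = (-1)^{kl} tr(A ∧ B)` up to the degree cast
  (`MatrixForm.trace_wedge_comm`) — the identity behind both the frame independence of
  `tr(Ωᵖ)` (`k = 0`) and its closedness (`k = 1`, `l = 2p`).
* Cast bookkeeping (`castDeg_wedge`, `wedge_castDeg`, `castDeg_sum`, `trace_castDeg`,
  `mulLeft_castDeg`, `mulRight_castDeg`, `castDeg_heq`).

## References

* S. Kobayashi, *Differential Geometry of Complex Vector Bundles* (1987), Ch. I §1 (1.12)–(1.17),
  Ch. II §2 (2.4), (2.21).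
* F. W. Warner, *Foundations of Differentiable Manifolds and Lie Groups* (GTM 94), 2.6, 2.10.
-/

noncomputable section

open scoped Manifold ContDiff Matrix
open Set

/-! ### Scalars from the coefficient algebra and the wedge product (pointwise) -/

namespace ContinuousAlternatingMap

section AlgebraScalars

variable {𝕜 : Type*} [RCLike 𝕜] {V : Type*} [NormedAddCommGroup V] [NormedSpace 𝕜 V]
  {A : Type*} [NormedCommRing A] [NormedAlgebra 𝕜 A] {k l : ℕ}

/-- `(c • α) ∧ β = c • (α ∧ β)` for a scalar `c` of the (commutative) coefficient algebra `A`
(Warner (1983), 2.6: `∧` is bilinear over the coefficients; from the shuffle formula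
`wedge_apply`). Deliberate extension of the Mathlib namespace `ContinuousAlternatingMap`, as the
tree's `wedge`. [cite: WarnerGTM94, 2.6] -/
theorem algebra_smul_wedge (c : A) (α : V [⋀^Fin k]→L[𝕜] A) (β : V [⋀^Fin l]→L[𝕜] A) :
    (c • α).wedge β = c • α.wedge β := by
  ext v
  simp only [wedge_apply, smul_apply, smul_eq_mul, Units.smul_def, Algebra.smul_def,
    Finset.mul_sum]
  exact Finset.sum_congr rfl fun σ _ ↦ by ring

/-- `α ∧ (c • β) = c • (α ∧ β)` for a scalar `c` of the coefficient algebra `A`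
(Warner (1983), 2.6). [cite: WarnerGTM94, 2.6] -/
theorem wedge_algebra_smul (c : A) (α : V [⋀^Fin k]→L[𝕜] A) (β : V [⋀^Fin l]→L[𝕜] A) :
    α.wedge (c • β) = c • α.wedge β := by
  ext v
  simp only [wedge_apply, smul_apply, smul_eq_mul, Units.smul_def, Algebra.smul_def,
    Finset.mul_sum]
  exact Finset.sum_congr rfl fun σ _ ↦ by ring

/-- The wedge product distributes over finite sums on the left (Warner (1983), 2.6).
[cite: WarnerGTM94, 2.6] -/
theorem sum_wedge {ι : Type*} (s : Finset ι) (α : ι → V [⋀^Fin k]→L[𝕜] A)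
    (β : V [⋀^Fin l]→L[𝕜] A) : (∑ i ∈ s, α i).wedge β = ∑ i ∈ s, (α i).wedge β := by
  classical
  induction s using Finset.induction_on with
  | empty => simp
  | insert i s hi ih => rw [Finset.sum_insert hi, Finset.sum_insert hi, wedge_add_left, ih]

/-- The wedge product distributes over finite sums on the right (Warner (1983), 2.6).
[cite: WarnerGTM94, 2.6] -/
theorem wedge_sum {ι : Type*} (s : Finset ι) (α : V [⋀^Fin k]→L[𝕜] A)
    (β : ι → V [⋀^Fin l]→L[𝕜] A) : α.wedge (∑ i ∈ s, β i) = ∑ i ∈ s, α.wedge (β i) := by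
  classical
  induction s using Finset.induction_on with
  | empty => simp
  | insert i s hi ih => rw [Finset.sum_insert hi, Finset.sum_insert hi, wedge_add_right, ih]

end AlgebraScalars

end ContinuousAlternatingMap

namespace Literature.Geometry.Kaehler

/-! ### Scalar forms: casts, function scalars -/

section ScalarForms

variable {E : Type*} [NormedAddCommGroup E] [NormedSpace ℝ E]
  {H : Type*} [TopologicalSpace H] {I : ModelWithCorners ℝ E H}
  {M : Type*} [TopologicalSpace M] [ChartedSpace H M]
  {A : Type*} [NormedCommRing A] [NormedAlgebra ℝ A] {k l m k' l' : ℕ}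

/-- A degree cast between definitionally equal degrees is the identity (`HEq` form, from which
`castDeg h α = α` follows by `eq_of_heq` whenever both sides have the same type). [folklore] -/
theorem MForm.castDeg_heq {F : Type*} [NormedAddCommGroup F] [NormedSpace ℝ F] (h : k = k')
    (α : MForm I M F k) : HEq (α.castDeg h) α := by
  subst h; rfl

/-- Wedge and degree cast on the left: `(α.castDeg h) ∧ β = (α ∧ β).castDeg _`. [folklore] -/
theorem MForm.castDeg_wedge (h : k = k') (α : MForm I M A k) (β : MForm I M A l) :
    (α.castDeg h).wedge β = (α.wedge β).castDeg (congrArg (· + l) h) := by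
  subst h; rfl

/-- Wedge and degree cast on the right: `α ∧ (β.castDeg h) = (α ∧ β).castDeg _`. [folklore] -/
theorem MForm.wedge_castDeg (h : l = l') (α : MForm I M A k) (β : MForm I M A l) :
    α.wedge (β.castDeg h) = (α.wedge β).castDeg (congrArg (k + ·) h) := by
  subst h; rfl

/-- Degree cast commutes with finite sums. [folklore] -/
theorem MForm.castDeg_sum {F : Type*} [NormedAddCommGroup F] [NormedSpace ℝ F] {ι : Type*}
    (s : Finset ι) (h : k = k') (α : ι → MForm I M F k) :
    (∑ i ∈ s, α i).castDeg h = ∑ i ∈ s, (α i).castDeg h := by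
  subst h
  simp only [MForm.castDeg_rfl]

/-- Pointwise algebra scalars pass through the wedge on the left:
`(x ↦ c(x) • α(x)) ∧ β = x ↦ c(x) • (α ∧ β)(x)`. [cite: WarnerGTM94, 2.6] -/
theorem MForm.funSmul_wedge (c : M → A) (α : MForm I M A k) (β : MForm I M A l) :
    MForm.wedge (fun x ↦ c x • α x) β = fun x ↦ c x • α.wedge β x :=
  funext fun x ↦ ContinuousAlternatingMap.algebra_smul_wedge (V := E) (c x) (α x) (β x)

/-- Pointwise algebra scalars pass through the wedge on the right. [cite: WarnerGTM94, 2.6] -/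
theorem MForm.wedge_funSmul (c : M → A) (α : MForm I M A k) (β : MForm I M A l) :
    α.wedge (fun x ↦ c x • β x) = fun x ↦ c x • α.wedge β x :=
  funext fun x ↦ ContinuousAlternatingMap.wedge_algebra_smul (V := E) (c x) (α x) (β x)

/-- The wedge of forms distributes over finite sums on the left. [cite: WarnerGTM94, 2.6] -/
theorem MForm.sum_wedge {ι : Type*} (s : Finset ι) (α : ι → MForm I M A k) (β : MForm I M A l) :
    MForm.wedge (∑ i ∈ s, α i) β = ∑ i ∈ s, (α i).wedge β := by
  funext x
  rw [Finset.sum_apply, MForm.wedge_apply, Finset.sum_apply]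
  exact ContinuousAlternatingMap.sum_wedge (V := E) s (fun i ↦ α i x) (β x)

/-- The wedge of forms distributes over finite sums on the right. [cite: WarnerGTM94, 2.6] -/
theorem MForm.wedge_sum {ι : Type*} (s : Finset ι) (α : MForm I M A k) (β : ι → MForm I M A l) :
    α.wedge (∑ i ∈ s, β i) = ∑ i ∈ s, α.wedge (β i) := by
  funext x
  rw [Finset.sum_apply, MForm.wedge_apply, Finset.sum_apply]
  exact ContinuousAlternatingMap.wedge_sum (V := E) s (α x) (fun i ↦ β i x)

end ScalarForms

/-! ### Matrices of forms -/

namespace MatrixForm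

variable {E : Type*} [NormedAddCommGroup E] [NormedSpace ℝ E]
  {H : Type*} [TopologicalSpace H] {I : ModelWithCorners ℝ E H}
  {M : Type*} [TopologicalSpace M] [ChartedSpace H M] {r k l m k' l' : ℕ}

/-- `(A + A') ∧ B = A ∧ B + A' ∧ B`. [cite: Kobayashi1987, Ch. I §1] -/
theorem add_wedge (A A' : MatrixForm I M r k) (B : MatrixForm I M r l) :
    (A + A').wedge B = A.wedge B + A'.wedge B := by
  ext a b : 2
  simp only [wedge_apply, Matrix.add_apply, MForm.wedge_add_left, Finset.sum_add_distrib]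

/-- `A ∧ (B + B') = A ∧ B + A ∧ B'`. [cite: Kobayashi1987, Ch. I §1] -/
theorem wedge_add (A : MatrixForm I M r k) (B B' : MatrixForm I M r l) :
    A.wedge (B + B') = A.wedge B + A.wedge B' := by
  ext a b : 2
  simp only [wedge_apply, Matrix.add_apply, MForm.wedge_add_right, Finset.sum_add_distrib]

/-- `(-A) ∧ B = -(A ∧ B)`. [cite: Kobayashi1987, Ch. I §1] -/
theorem neg_wedge (A : MatrixForm I M r k) (B : MatrixForm I M r l) :
    (-A).wedge B = -(A.wedge B) := by
  have h := add_wedge A (-A) B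
  rw [add_neg_cancel, zero_wedge] at h
  exact (neg_eq_of_add_eq_zero_right h.symm).symm

/-- `A ∧ (-B) = -(A ∧ B)`. [cite: Kobayashi1987, Ch. I §1] -/
theorem wedge_neg (A : MatrixForm I M r k) (B : MatrixForm I M r l) :
    A.wedge (-B) = -(A.wedge B) := by
  have h := wedge_add A B (-B)
  rw [add_neg_cancel, wedge_zero] at h
  exact (neg_eq_of_add_eq_zero_right h.symm).symm

/-- Real scalars pass through the matrix wedge on the left. [cite: Kobayashi1987, Ch. I §1] -/
theorem smul_wedge (c : ℝ) (A : MatrixForm I M r k) (B : MatrixForm I M r l) :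
    (c • A).wedge B = c • A.wedge B := by
  ext a b : 2
  simp only [wedge_apply, Matrix.smul_apply, MForm.wedge_smul_left, Finset.smul_sum]

/-- Real scalars pass through the matrix wedge on the right. [cite: Kobayashi1987, Ch. I §1] -/
theorem wedge_smul (c : ℝ) (A : MatrixForm I M r k) (B : MatrixForm I M r l) :
    A.wedge (c • B) = c • A.wedge B := by
  ext a b : 2
  simp only [wedge_apply, Matrix.smul_apply, MForm.wedge_smul_right, Finset.smul_sum]

/-- Degree cast of a matrix wedge, left factor. [folklore] -/
theorem castDeg_wedge (h : k = k') (A : MatrixForm I M r k) (B : MatrixForm I M r l) :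
    (A.castDeg h).wedge B = (A.wedge B).castDeg (congrArg (· + l) h) := by
  subst h; rfl

/-- Degree cast of a matrix wedge, right factor. [folklore] -/
theorem wedge_castDeg (h : l = l') (A : MatrixForm I M r k) (B : MatrixForm I M r l) :
    A.wedge (B.castDeg h) = (A.wedge B).castDeg (congrArg (k + ·) h) := by
  subst h; rfl

/-- Degree casts compose. [folklore] -/
theorem castDeg_castDeg {k'' : ℕ} (h : k = k') (h' : k' = k'') (A : MatrixForm I M r k) :
    (A.castDeg h).castDeg h' = A.castDeg (h.trans h') := by
  subst h h'; rfl

/-- Casting along `rfl` does nothing. [folklore] -/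
@[simp]
theorem castDeg_rfl (A : MatrixForm I M r k) : A.castDeg rfl = A := rfl

/-- A degree cast between definitionally equal degrees is the identity (`HEq` form). [folklore] -/
theorem castDeg_heq (h : k = k') (A : MatrixForm I M r k) : HEq (A.castDeg h) A := by
  subst h; rfl

/-- Degree cast is additive. [folklore] -/
theorem castDeg_add (h : k = k') (A B : MatrixForm I M r k) :
    (A + B).castDeg h = A.castDeg h + B.castDeg h := by
  subst h; rfl

/-- Degree cast commutes with negation. [folklore] -/
theorem castDeg_neg (h : k = k') (A : MatrixForm I M r k) : (-A).castDeg h = -A.castDeg h := by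
  subst h; rfl

/-- Degree cast commutes with subtraction. [folklore] -/
theorem castDeg_sub (h : k = k') (A B : MatrixForm I M r k) :
    (A - B).castDeg h = A.castDeg h - B.castDeg h := by
  subst h; rfl

/-- Degree cast commutes with real scalars. [folklore] -/
theorem castDeg_smul (h : k = k') (c : ℝ) (A : MatrixForm I M r k) :
    (c • A).castDeg h = c • A.castDeg h := by
  subst h; rfl

/-- The trace commutes with degree casts. [folklore] -/
theorem trace_castDeg (h : k = k') (A : MatrixForm I M r k) :
    (A.castDeg h).trace = (A.trace).castDeg h := by
  subst h; rfl

/-- Left multiplication commutes with degree casts. [folklore] -/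
theorem mulLeft_castDeg (h : k = k') (g : M → Matrix (Fin r) (Fin r) ℂ) (A : MatrixForm I M r k) :
    mulLeft g (A.castDeg h) = (mulLeft g A).castDeg h := by
  subst h; rfl

/-- Right multiplication commutes with degree casts. [folklore] -/
theorem mulRight_castDeg (h : k = k') (A : MatrixForm I M r k) (g : M → Matrix (Fin r) (Fin r) ℂ) :
    (A.castDeg h).mulRight g = (A.mulRight g).castDeg h := by
  subst h; rfl

/-! #### Multiplication by matrix-valued functions -/

/-- `g · (A ∧ B) = (g · A) ∧ B` (`∧` is linear over functions). [cite: Kobayashi1987, Ch. I §1 (1.16)–(1.17)] -/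
theorem mulLeft_wedge (g : M → Matrix (Fin r) (Fin r) ℂ) (A : MatrixForm I M r k)
    (B : MatrixForm I M r l) : mulLeft g (A.wedge B) = (mulLeft g A).wedge B := by
  ext a b x : 2
  have hm : ∀ d, (mulLeft g A) a d = ∑ c, (fun y ↦ g y a c • A c d y) := fun d ↦ by
    funext y
    simp only [Finset.sum_apply, mulLeft_apply]
  simp only [mulLeft_apply, wedge_apply, Finset.sum_apply, Finset.smul_sum, hm, MForm.sum_wedge,
    MForm.funSmul_wedge]
  exact Finset.sum_comm

/-- `(A ∧ B) · g = A ∧ (B · g)`. [cite: Kobayashi1987, Ch. I §1 (1.16)–(1.17)] -/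
theorem wedge_mulRight (A : MatrixForm I M r k) (B : MatrixForm I M r l)
    (g : M → Matrix (Fin r) (Fin r) ℂ) : (A.wedge B).mulRight g = A.wedge (B.mulRight g) := by
  ext a b x : 2
  have hm : ∀ d, (B.mulRight g) d b = ∑ c, (fun y ↦ g y c b • B d c y) := fun d ↦ by
    funext y
    simp only [Finset.sum_apply, mulRight_apply]
  simp only [mulRight_apply, wedge_apply, Finset.sum_apply, Finset.smul_sum, hm, MForm.wedge_sum,
    MForm.wedge_funSmul]
  exact Finset.sum_comm

/-- `(A · g) ∧ B = A ∧ (g · B)` (move a function factor across the wedge).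
[cite: Kobayashi1987, Ch. I §1 (1.16)–(1.17)] -/
theorem mulRight_wedge (A : MatrixForm I M r k) (g : M → Matrix (Fin r) (Fin r) ℂ)
    (B : MatrixForm I M r l) : (A.mulRight g).wedge B = A.wedge (mulLeft g B) := by
  ext a b x : 2
  have hm : ∀ c, (A.mulRight g) a c = ∑ d, (fun y ↦ g y d c • A a d y) := fun c ↦ by
    funext y
    simp only [Finset.sum_apply, mulRight_apply]
  have hm' : ∀ d, (mulLeft g B) d b = ∑ c, (fun y ↦ g y d c • B c b y) := fun d ↦ by
    funext y
    simp only [Finset.sum_apply, mulLeft_apply]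
  simp only [wedge_apply, Finset.sum_apply, hm, hm', MForm.sum_wedge, MForm.wedge_sum,
    MForm.funSmul_wedge, MForm.wedge_funSmul]
  exact Finset.sum_comm

/-- `g · (h · A) = (g h) · A` (pointwise matrix product of the function factors).
[cite: Kobayashi1987, Ch. I §1] -/
theorem mulLeft_mulLeft (g h : M → Matrix (Fin r) (Fin r) ℂ) (A : MatrixForm I M r k) :
    mulLeft g (mulLeft h A) = mulLeft (g * h) A := by
  ext a b x : 2
  simp only [mulLeft_apply, Pi.mul_apply, Matrix.mul_apply, Finset.smul_sum, Finset.sum_smul,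
    smul_smul]
  exact Finset.sum_comm

/-- `(A · g) · h = A · (g h)`. [cite: Kobayashi1987, Ch. I §1] -/
theorem mulRight_mulRight (A : MatrixForm I M r k) (g h : M → Matrix (Fin r) (Fin r) ℂ) :
    (A.mulRight g).mulRight h = A.mulRight (g * h) := by
  ext a b x : 2
  simp only [mulRight_apply, Pi.mul_apply, Matrix.mul_apply, Finset.smul_sum, Finset.sum_smul,
    smul_smul]
  rw [Finset.sum_comm]
  exact Finset.sum_congr rfl fun c _ ↦ Finset.sum_congr rfl fun d _ ↦ by rw [mul_comm]

/-- `(g · A) · h = g · (A · h)`. [cite: Kobayashi1987, Ch. I §1] -/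
theorem mulLeft_mulRight (g : M → Matrix (Fin r) (Fin r) ℂ) (A : MatrixForm I M r k)
    (h : M → Matrix (Fin r) (Fin r) ℂ) : (mulLeft g A).mulRight h = mulLeft g (A.mulRight h) := by
  ext a b x : 2
  simp only [mulLeft_apply, mulRight_apply, Finset.smul_sum, smul_smul]
  rw [Finset.sum_comm]
  exact Finset.sum_congr rfl fun c _ ↦ Finset.sum_congr rfl fun d _ ↦ by rw [mul_comm]

/-- `mulLeft` is additive in the form. [cite: Kobayashi1987, Ch. I §1] -/
theorem mulLeft_add (g : M → Matrix (Fin r) (Fin r) ℂ) (A B : MatrixForm I M r k) :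
    mulLeft g (A + B) = mulLeft g A + mulLeft g B := by
  ext a b x : 2
  simp only [mulLeft_apply, Matrix.add_apply, Pi.add_apply, smul_add, Finset.sum_add_distrib]

/-- `mulRight` is additive in the form. [cite: Kobayashi1987, Ch. I §1] -/
theorem mulRight_add (A B : MatrixForm I M r k) (g : M → Matrix (Fin r) (Fin r) ℂ) :
    (A + B).mulRight g = A.mulRight g + B.mulRight g := by
  ext a b x : 2
  simp only [mulRight_apply, Matrix.add_apply, Pi.add_apply, smul_add, Finset.sum_add_distrib]

/-- At a point where `g = 1`, left multiplication by `g` does nothing. [folklore] -/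
theorem mulLeft_apply_of_eq_one {g : M → Matrix (Fin r) (Fin r) ℂ} {x : M} (hg : g x = 1)
    (A : MatrixForm I M r k) (a b : Fin r) : mulLeft g A a b x = A a b x := by
  simp only [mulLeft_apply, hg, Matrix.one_apply, ite_smul, one_smul, zero_smul,
    Finset.sum_ite_eq, Finset.mem_univ, if_true]

/-- At a point where `g = 1`, right multiplication by `g` does nothing. [folklore] -/
theorem mulRight_apply_of_eq_one {g : M → Matrix (Fin r) (Fin r) ℂ} {x : M} (hg : g x = 1)
    (A : MatrixForm I M r k) (a b : Fin r) : mulRight A g a b x = A a b x := by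
  simp only [mulRight_apply, hg, Matrix.one_apply, ite_smul, one_smul, zero_smul,
    Finset.sum_ite_eq', Finset.mem_univ, if_true]

/-! #### Associativity and the graded-cyclic trace -/

/-- **Associativity of the matrix wedge**: `(A ∧ B) ∧ C = A ∧ (B ∧ C)` up to the degree cast
along `k + (l + m) = (k + l) + m` (from associativity of `∧` on scalar forms, proved in the tree:
`ContinuousAlternatingMap.WedgeAssoc_holds`, and bilinearity). [cite: Kobayashi1987, Ch. I §1 (1.12)] -/
theorem wedge_assoc (A : MatrixForm I M r k) (B : MatrixForm I M r l) (C : MatrixForm I M r m) :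
    (A.wedge B).wedge C = (A.wedge (B.wedge C)).castDeg (Nat.add_assoc k l m).symm := by
  haveI : Literature.NumberTheory.Transcendental.WedgeFacts I M ℂ :=
    Literature.NumberTheory.Transcendental.wedgeFacts_of_assoc I M ℂ
      (ContinuousAlternatingMap.WedgeAssoc_holds ℝ E ℂ)
  refine Matrix.ext fun a b ↦ ?_
  simp only [wedge_apply, castDeg_apply]
  have hL : ∀ c, (MForm.wedge (∑ d, (A a d).wedge (B d c)) (C c b)) =
      ∑ d, ((A a d).wedge (B d c)).wedge (C c b) := fun c ↦ MForm.sum_wedge _ _ _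
  have hR : ∀ d, (A a d).wedge (∑ c, (B d c).wedge (C c b)) =
      ∑ c, (A a d).wedge ((B d c).wedge (C c b)) := fun d ↦ MForm.wedge_sum _ _ _
  simp only [hL, hR, MForm.castDeg_sum]
  rw [Finset.sum_comm]
  refine Finset.sum_congr rfl fun d _ ↦ Finset.sum_congr rfl fun c _ ↦ ?_
  rw [MForm.wedge_assoc]

/-- **Graded cyclicity of the trace**: `tr(B ∧ A) = (-1)^{kl} tr(A ∧ B)` up to the degree cast
along `k + l = l + k`, for matrices `A`, `B` of forms of degrees `k`, `l` (swap the two matrix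
indices and use graded commutativity of `∧` on scalar forms, proved in the tree:
`ContinuousAlternatingMap.WedgeComm_holds`). For `k` or `l` even this is the cyclic invariance
`tr(A ∧ B) = tr(B ∧ A)` used for the frame independence and the closedness of `tr(Ωᵖ)`.
[cite: Kobayashi1987, Ch. II §2 (2.4)] -/
theorem trace_wedge_comm (A : MatrixForm I M r k) (B : MatrixForm I M r l) :
    (B.wedge A).trace = ((-1 : ℝ) ^ (k * l)) • ((A.wedge B).trace).castDeg (Nat.add_comm k l) := by
  haveI : Literature.NumberTheory.Transcendental.WedgeFacts I M ℂ :=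
    Literature.NumberTheory.Transcendental.wedgeFacts_of_assoc I M ℂ
      (ContinuousAlternatingMap.WedgeAssoc_holds ℝ E ℂ)
  simp only [Matrix.trace, Matrix.diag_apply, wedge_apply, MForm.castDeg_sum, Finset.smul_sum]
  rw [Finset.sum_comm]
  exact Finset.sum_congr rfl fun a _ ↦ Finset.sum_congr rfl fun c _ ↦ MForm.wedge_comm (A a c) (B c a)

/-- Trace and left multiplication by a function commute with each other in the cyclic sense:
`tr(g · A) = tr(A · g)`. [folklore] -/
theorem trace_mulLeft (g : M → Matrix (Fin r) (Fin r) ℂ) (A : MatrixForm I M r k) :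
    (mulLeft g A).trace = (A.mulRight g).trace := by
  simp only [Matrix.trace, Matrix.diag_apply]
  funext x
  simp only [Finset.sum_apply, mulLeft_apply, mulRight_apply]
  exact Finset.sum_comm

end MatrixForm

end Literature.Geometry.Kaehler

end
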